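import Summits.BirchSwinnertonDyer.BirchSwinnertonDyer.Theorems.UniversalToricDescentTwinBoundedIndexGlue
import Summits.BirchSwinnertonDyer.BirchSwinnertonDyer.Theorems.UniversalToricDescentHeegnerClassNotDivisible
import Summits.BirchSwinnertonDyer.BirchSwinnertonDyer.Theorems.UniversalToricDescentK2BetaOfSpecializedIndex
import Literature.NumberTheory.EllipticCurves.IwasawaAlgebraSpecializationDeviceProofs
import HarnessLib

/-!
# K2_res of line `beta-road` from K1 and Howard's conclusion ALONE: K1 ⟹ `(proj_k 𝐳_∞)_1 ≠ 0` ⟹ non-divisible control images;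
# bounded torsion index ⟹ `μ(X_tors) = 0`; with (H-ii) ⟹ the residual corank-one bound — no freeness of `𝔖`, no `𝔖 ≅ Λ`, no
# finite generation of `𝔖`

Summits-side helper toward crux r205 stmt-BirchSwinnertonDyer-24737 `…Theses.UniversalToricDescent.TwinAlgMuZeroAtThree`, line
`beta-road` (LEAD lineage `bsd-wall-utd-p1`, g27; `--supports`).  ROUTE-INDEPENDENT; THEOREMS ONLY (no definition, no named fact, no
instance, no `sorry`).  Companion of `UniversalToricDescentTwinBoundedIndexGlue` (the bounded-index glue).

WHAT.
* `proj_one_ne_zero_of_layerIndivisible` — K1 at layer `k` for a subgroup `D ≤ Γ_K` (every `p`-th root `Q` of the layer point `z_k`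
  of the Heegner family has non-zero Kummer class over `Γ_{K_k} ∩ D`) ⟹ the level-`(k, 1)` component `(proj_k 𝐳_∞)_1 ∈ H¹(K_k, E[p])`
  of the `Λ`-adic Heegner class is non-zero (component formula `IsLambdaAdicHeegnerClass.proj_eq` + restriction; the E6 argument
  of `UniversalToricDescentHeegnerClassNotDivisible` one step earlier).
* `toEisensteinH1Linear_not_mem_of_layerIndivisible` — hence, for every `m ≥ p^k`, every transition datum and every pin `I`, the
  compact control image `f_m 𝐳_∞ ∉ T^{p^k} • H¹(K, T_{q_m})` (`LambdaAdicSelmerData.toEisensteinH1Linear_not_mem_X_pow_smul_top`,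
  p655750).
* `muInvariant_eq_zero_of_natCard_quotSMulTop_qm_le` — GENERIC: a f.g. torsion `Λ`-module `N` with `#(N ⧸ q_m N) ≤ p^C` for all
  large `m` has `μ(N) = 0` (the tree's `μ`-transfer `IwasawaAlgebra.muInvariant_le_mul_of_card_quotSMulTop_qm_le` at exponent `0`).
* **`twin_muInvariant_torsion_eq_zero_of_conclusion`** and **`twin_k2Res_of_conclusion_of_layerIndivisible`** — in the binders of
  crux 24737 at `p = 3`: for a `Λ`-adic Selmer datum `Dat`, the `Λ`-adic Heegner class `z` of a family `F` (sign `α`, `α² = 1`) with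
  the K1 datum at some layer, Howard's conclusion at the control levels of `z` for all large `m`
  (`Stmt.conclusionAtControlLevels 3 …`) ⟹ `μ(X_tors) = 0` and the residual corank-one bound
  `∃ C, ∀ n, #Sel_{3^∞}(E′/K_∞)[3]^{γ^{3ⁿ}} ≤ 3^{3ⁿ + C}` (K2_res) — via the bounded-index glue
  (`twin_natCard_torsion_quot_le_of_conclusion_of_notDivisible`), (H-ii) `twin_hrank_of_conclusion` (p765649),
  `finrank_le_one_of_lambdaInvariant_quotient_X_pow_add_C_le` and `k2ResBound_of_finrank_le_one_of_mu_eq_zero` (p747307).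
So in skeleton v12 of the line the stub K2b `stub_cyclicSpecializationOfConclusion` (freeness of `𝔖`) and the binder
`Module.Finite Λ 𝔖` DISAPPEAR: K2_res follows from K1 + K2a's `(Dat, z, IsLambdaAdicHeegnerClass, conclusion)` alone.
What this is NOT: the Kolyvagin system / Howard's conclusion for the twin (K2a), K1, C₀.  No summit statement is proved; BSD is not
proved by any of this.

References: [Howard2004HeegnerKolyvagin] Thm. 1.6.1, Thm. B, §2.3, Prop. 2.2.8 and proof of Thm. 2.2.10 (𝔮 = T^m + p);
[BertoliniDarmon1996] §2.5 eq. (7)–(8); [GreenbergLNM1716] §1 p. 60; [Washington1997] §13.2.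
-/

set_option linter.dupNamespace false
set_option autoImplicit false

noncomputable section

open scoped Classical NumberField ContRepresentation

open Function NumberField IsDedekindDomain Field
open Literature Literature.NumberTheory.EllipticCurves WeierstrassCurve
open Literature.NumberTheory.EllipticCurves.IwasawaAlgebra Literature.NumberTheory.EllipticCurves.Castella2024
open Summit.BirchSwinnertonDyer.BirchSwinnertonDyer.Theorems
open Summit.BirchSwinnertonDyer.BirchSwinnertonDyer.Theorems.UniversalToricDescentHeegnerClassKummerBridge
open Summit.BirchSwinnertonDyer.BirchSwinnertonDyer.Theorems.UniversalToricDescentTwinHowardConclusion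
open Summit.BirchSwinnertonDyer.BirchSwinnertonDyer.Theorems.UniversalToricDescentTwinBoundedIndexGlue
open Summit.BirchSwinnertonDyer.BirchSwinnertonDyer.Theorems.UniversalToricDescentEisensteinSpecializationRank
open Summit.BirchSwinnertonDyer.BirchSwinnertonDyer.Theorems.UniversalToricDescentResidualGrowthSelmerSide

namespace Summit.BirchSwinnertonDyer.BirchSwinnertonDyer.Theorems.UniversalToricDescentTwinK2ResOfConclusion

universe u

/-! ## §1 K1 ⟹ the precision-one component of the `Λ`-adic Heegner class is non-zero ⟹ non-divisible control images -/

section K1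

variable {K : Type u} [Field K] [NumberField K] {N : ℕ} [NeZero N] {W : WeierstrassCurve ℚ}
  {p : ℕ} [hp : Fact p.Prime] {κ : ZpExtension K p} {γ : Field.absoluteGaloisGroup K}
  {jbar : AlgebraicClosure K →+* ℂ}

/-- **K1 ⟹ `(proj_k 𝐳_∞)_1 ≠ 0`.**  Let `z ∈ 𝔖` be the `Λ`-adic Heegner class of the family `F` with sign `α` (`α² = 1`) and
`D ≤ Γ_K` a subgroup.  If at layer `k` every `p`-th root `Q` of the norm point `z_k = F.z k` has NON-ZERO Kummer class over
`Γ_{K_k} ∩ D` (K1: the layer point is locally `p`-indivisible), then the level-`(k, 1)` component `(proj_k z)_1 ∈ H¹(Γ_{K_k}, E[p])`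
is non-zero: by the component formula it is `α^{k+1}·δ(Q)`, whose restriction to `Γ_{K_k} ∩ D` is non-zero.
[cite: BertoliniDarmon1996, §2.5 eq. (7)–(8)] [cite: Howard2004HeegnerKolyvagin, §2.3 (proof of Thm. B)] -/
theorem proj_one_ne_zero_of_layerIndivisible
    (Dat : (W.baseChange K).LambdaAdicSelmerData κ γ) (F : HeegnerFamily N W K κ jbar)
    {α : ℤ} (hα : α ^ 2 = 1) {z : Dat.S} (hz : IsLambdaAdicHeegnerClass Dat F α z)
    (Dg : Subgroup (Field.absoluteGaloisGroup K)) {k : ℕ}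
    (hK1 : ∀ (Q : geomPoints (W.baseChange K))
      (hQ : ∀ σ ∈ κ.layerSubgroup k ⊓ Dg, σ • (((p : ℤ) ^ 1) • Q) = ((p : ℤ) ^ 1) • Q),
      ((p : ℤ) ^ 1) • Q = F.z k →
        (W.baseChange K).kummerClassOver (κ.layerSubgroup k ⊓ Dg) ((p : ℤ) ^ 1) Q hQ ≠ 0) :
    Dat.proj k z 1 ≠ 0 := by
  intro h0
  have hp1 : ((p : ℤ) ^ 1) ≠ 0 := pow_ne_zero _ (by exact_mod_cast (Fact.out : p.Prime).ne_zero)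
  obtain ⟨Q, hQ⟩ := (W.baseChange K).zsmul_geomPoints_surjective_of_charZero hp1 (F.z k)
  dsimp only at hQ
  have hfix : ∀ σ ∈ κ.layerSubgroup k ⊓ Dg, σ • (((p : ℤ) ^ 1) • Q) = ((p : ℤ) ^ 1) • Q := fun σ hσ ↦ by
    rw [hQ]; exact (F.isHeegnerNormPoint_z k).smul_eq_self (inf_le_left (b := Dg) hσ)
  rw [hz.proj_eq k 1 Q hQ] at h0
  have h1 := congrArg (Literature.NumberTheory.EllipticCurves.resOfLe (geomTorsion (W.baseChange K) ((p : ℤ) ^ 1))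
    (inf_le_left : κ.layerSubgroup k ⊓ Dg ≤ κ.layerSubgroup k)) h0
  rw [map_zsmul, WeierstrassCurve.resOfLe_kummerClassOver, map_zero] at h1
  exact hK1 Q hfix hQ (zsmul_eq_zero_of_sq_eq_one hα k h1)

/-- **K1 ⟹ non-divisible control images**: under the hypotheses of `proj_one_ne_zero_of_layerIndivisible` (curve elliptic over `K`,
`E(K)[p] = 0`, `γ` a topological generator), for every `m ≥ p^k`, every transition datum `t, ht` and every pin `I` of
`H¹(K, T_{q_m})`: `f_m z = toEisensteinH1Linear … z ∉ T^{p^k} • H¹(K, T_{q_m})` (p655750).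
[cite: Howard2004HeegnerKolyvagin, §2.2, Prop. 2.2.8 and proof of Thm. 2.2.10 (𝔮 = T^m + p)] [cite: BertoliniDarmon1996, §2.5 eq. (7)–(8)] -/
theorem toEisensteinH1Linear_not_mem_of_layerIndivisible [(W.baseChange K).IsElliptic]
    (Dat : (W.baseChange K).LambdaAdicSelmerData κ γ) (F : HeegnerFamily N W K κ jbar)
    {α : ℤ} (hα : α ^ 2 = 1) {z : Dat.S} (hz : IsLambdaAdicHeegnerClass Dat F α z)
    (Dg : Subgroup (Field.absoluteGaloisGroup K)) {k : ℕ}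
    (hK1 : ∀ (Q : geomPoints (W.baseChange K))
      (hQ : ∀ σ ∈ κ.layerSubgroup k ⊓ Dg, σ • (((p : ℤ) ^ 1) • Q) = ((p : ℤ) ^ 1) • Q),
      ((p : ℤ) ^ 1) • Q = F.z k →
        (W.baseChange K).kummerClassOver (κ.layerSubgroup k ⊓ Dg) ((p : ℤ) ^ 1) Q hQ ≠ 0)
    (hγ : κ.IsTopGenerator γ) (hE : ∀ P : (W.baseChange K).toAffine.Point, p • P = 0 → P = 0) :
    ∀ (m : ℕ) (hm : 1 ≤ m), p ^ k ≤ m →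
      ∀ (t : ∀ j, ((W.baseChange K).torsionGaloisModule ((p : ℤ) ^ (j + 1))).toContRepresentation →ⁱL
          ((W.baseChange K).torsionGaloisModule ((p : ℤ) ^ j)).toContRepresentation)
        (ht : ∀ j (P : geomTorsion (W.baseChange K) ((p : ℤ) ^ (j + 1))), t j P = (W.baseChange K).geomTorsionReduce p j P)
        (I : ZpExtension.EisensteinH1Data (κ.unitTwist (-1))
          (fun j ↦ (W.baseChange K).torsionGaloisModule ((p : ℤ) ^ j)) t hm),
        Dat.toEisensteinH1Linear hm t ht I hγ hE z ∉
          (Ideal.span {(PowerSeries.X : IwasawaAlgebra p) ^ (p ^ k)} • ⊤ : Submodule (IwasawaAlgebra p) I.H) :=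
  fun _ hm hkm t ht I ↦ Dat.toEisensteinH1Linear_not_mem_X_pow_smul_top hm t ht I hγ hE hkm z
    (proj_one_ne_zero_of_layerIndivisible Dat F hα hz Dg hK1)

end K1

/-! ## §2 A bounded specialised index forces `μ = 0` -/

/-- **`#(N ⧸ q_m N) ≤ p^C` for all large `m` ⟹ `μ(N) = 0`** (`N` f.g. torsion over `Λ = ℤ_p⟦T⟧`, `q_m = T^m + p`): the tree's
`μ`-transfer `IwasawaAlgebra.muInvariant_le_mul_of_card_quotSMulTop_qm_le` at exponent `0` (`μ(N) ≤ 0·μ(N)`).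
[cite: Howard2004HeegnerKolyvagin, proof of Thm. 2.2.10 (specialisation at T^m + p)] [cite: Washington1997, §13.2] -/
theorem muInvariant_eq_zero_of_natCard_quotSMulTop_qm_le {p : ℕ} [Fact p.Prime] {N : Type*} [AddCommGroup N]
    [Module (IwasawaAlgebra p) N] [Module.Finite (IwasawaAlgebra p) N] (hN : Module.IsTorsion (IwasawaAlgebra p) N)
    (h : ∃ C m₀ : ℕ, ∀ m : ℕ, m₀ ≤ m →
      Nat.card (N ⧸ (Ideal.span {(PowerSeries.X ^ m + PowerSeries.C (p : ℤ_[p]) : IwasawaAlgebra p)} • ⊤ :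
        Submodule (IwasawaAlgebra p) N)) ≤ p ^ C) :
    muInvariant p N = 0 := by
  obtain ⟨C, m₀, hC⟩ := h
  have hle := IwasawaAlgebra.muInvariant_le_mul_of_card_quotSMulTop_qm_le p N N hN hN (k := 0)
    ⟨C, m₀, fun m hm ↦ by rw [pow_zero, mul_one]; exact hC m hm⟩
  rw [zero_mul] at hle
  exact Nat.le_zero.mp hle

/-! ## §3 The twin at `p = 3`: `μ(X_tors) = 0` and K2_res from K1 + Howard's conclusion -/

/-- **`μ(X_tors) = 0` for the twin from Howard's conclusion and non-divisible control images** (crux-24737 binders; `X` the dual of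
`Sel_{3^∞}(E′/K_∞)`): `twin_natCard_torsion_quot_le_of_conclusion_of_notDivisible` + §2.
[cite: Howard2004HeegnerKolyvagin, Thm. 1.6.1, Thm. B and proof of Thm. 2.2.10 (𝔮 = T^m + p)] [cite: Washington1997, §13.2] -/
theorem twin_muInvariant_torsion_eq_zero_of_conclusion
    (W' : WeierstrassCurve ℚ) [W'.IsElliptic] [W'.IsGloballyMinimal] (N' : ℕ) [NeZero N']
    (K : Type) [Field K] [NumberField K]
    (hm3 : Rank1Residual.Mult W' 3) (hsurj : W'.HasSurjectiveModNGaloisRep 3) (hK : IsImaginaryQuadratic K)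
    (hH : SatisfiesHeegnerHypothesis N' K) (κ : ZpExtension K 3) (hκ : κ.IsAnticyclotomic)
    (γ : absoluteGaloisGroup K) [hγ : Fact (κ.IsTopGenerator γ)]
    (Dat : (W'.baseChange K).LambdaAdicSelmerData κ γ) (z : Dat.S) {j : ℕ}
    (hndiv : ∀ (m : ℕ) (hm : 1 ≤ m), j ≤ m →
      ∀ (t : ∀ k, ((W'.baseChange K).torsionGaloisModule (((3 : ℕ) : ℤ) ^ (k + 1))).toContRepresentation →ⁱL
          ((W'.baseChange K).torsionGaloisModule (((3 : ℕ) : ℤ) ^ k)).toContRepresentation)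
        (ht : ∀ k (P : geomTorsion (W'.baseChange K) (((3 : ℕ) : ℤ) ^ (k + 1))),
          t k P = (W'.baseChange K).geomTorsionReduce 3 k P)
        (I : ZpExtension.EisensteinH1Data (κ.unitTwist (-1))
          (fun k ↦ (W'.baseChange K).torsionGaloisModule (((3 : ℕ) : ℤ) ^ k)) t hm),
        Dat.toEisensteinH1Linear hm t ht I hγ.out
            (UniversalToricDescentTowerTorsion.baseChange_noPTorsion_of_surjective W' 3 hsurj K hK) z ∉
          (Ideal.span {(PowerSeries.X : IwasawaAlgebra 3) ^ j} • ⊤ : Submodule (IwasawaAlgebra 3) I.H))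
    (hconc : Stmt.conclusionAtControlLevels 3 N' W' K κ γ hγ.out
      (UniversalToricDescentTowerTorsion.baseChange_noPTorsion_of_surjective W' 3 hsurj K hK) Dat z) :
    muInvariant 3 (Submodule.torsion (IwasawaAlgebra 3) ((W'.baseChange K).selmerDualData κ hγ.out).X) = 0 := by
  haveI : Module.Finite (IwasawaAlgebra 3) ((W'.baseChange K).selmerDualData κ hγ.out).X :=
    ((W'.baseChange K).selmerDualData κ hγ.out).module_finite_holds hγ.out
  haveI : IsNoetherian (IwasawaAlgebra 3) ((W'.baseChange K).selmerDualData κ hγ.out).X :=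
    isNoetherian_of_isNoetherianRing_of_finite _ _
  haveI : Module.Finite (IwasawaAlgebra 3)
      ↥(Submodule.torsion (IwasawaAlgebra 3) ((W'.baseChange K).selmerDualData κ hγ.out).X) :=
    Module.Finite.iff_fg.mpr (IsNoetherian.noetherian _)
  exact muInvariant_eq_zero_of_natCard_quotSMulTop_qm_le (p := 3) Submodule.torsion_isTorsion
    (twin_natCard_torsion_quot_le_of_conclusion_of_notDivisible W' N' K hm3 hsurj hK hH κ hκ γ Dat z hndiv hconc)

/-- **K2_res of line `beta-road` from K1 + Howard's conclusion ALONE.**  In the binders of crux 24737 (bucket B: `Mult W′ 3`, `ρ̄₃` onto,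
`K` imaginary quadratic Heegner for `N′`, `κ` anticyclotomic, `γ` a topological generator): for a Heegner family `F` of the twin, a
sign `α` (`α² = 1`), a `Λ`-adic Selmer datum `Dat` and the `Λ`-adic Heegner class `z` of `F` in it (`IsLambdaAdicHeegnerClass`), the
K1 datum at some layer `k` for a subgroup `D ≤ Γ_K` (e.g. `D = D_𝔭`), and Howard's conclusion at the control levels of `z` for all
large `m`: `∃ C, ∀ n, #{s ∈ Sel_{3^∞}(E′/K_∞) : 3s = 0, γ^{3ⁿ}s = s} ≤ 3^{3ⁿ + C}`.  Chain: K1 ⟹ `(proj_k z)_1 ≠ 0` ⟹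
`f_m z ∉ T^{3^k}·H¹(K, T_{q_m})` (`m ≥ 3^k`) ⟹ `#(X_tors/q_m) ≤ 3^{C′}` uniformly (bounded-index glue) ⟹ `μ(X_tors) = 0`; (H-ii)
`twin_hrank_of_conclusion` ⟹ `rank_Λ X ≤ 1`; then `k2ResBound_of_finrank_le_one_of_mu_eq_zero`.  NO freeness / rank / finite
generation of `𝔖` is used.
[cite: Howard2004HeegnerKolyvagin, Thm. 1.6.1, Thm. B, §2.3 and proof of Thm. 2.2.10] [cite: GreenbergLNM1716, §1 p. 60] -/
theorem twin_k2Res_of_conclusion_of_layerIndivisible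
    (W' : WeierstrassCurve ℚ) [W'.IsElliptic] [W'.IsGloballyMinimal] (N' : ℕ) [NeZero N']
    (K : Type) [Field K] [NumberField K]
    (hm3 : Rank1Residual.Mult W' 3) (hsurj : W'.HasSurjectiveModNGaloisRep 3) (hK : IsImaginaryQuadratic K)
    (hH : SatisfiesHeegnerHypothesis N' K) (κ : ZpExtension K 3) (hκ : κ.IsAnticyclotomic)
    (γ : absoluteGaloisGroup K) [hγ : Fact (κ.IsTopGenerator γ)]
    {jbar : AlgebraicClosure K →+* ℂ} (F : HeegnerFamily N' W' K κ jbar) {α : ℤ} (hα : α ^ 2 = 1)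
    (Dat : (W'.baseChange K).LambdaAdicSelmerData κ γ) {z : Dat.S} (hz : IsLambdaAdicHeegnerClass Dat F α z)
    (Dg : Subgroup (Field.absoluteGaloisGroup K))
    (hK1 : ∃ k : ℕ, ∀ (Q : geomPoints (W'.baseChange K))
      (hQ : ∀ σ ∈ κ.layerSubgroup k ⊓ Dg, σ • ((((3 : ℕ) : ℤ) ^ 1) • Q) = (((3 : ℕ) : ℤ) ^ 1) • Q),
      (((3 : ℕ) : ℤ) ^ 1) • Q = F.z k →
        (W'.baseChange K).kummerClassOver (κ.layerSubgroup k ⊓ Dg) (((3 : ℕ) : ℤ) ^ 1) Q hQ ≠ 0)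
    (hconc : Stmt.conclusionAtControlLevels 3 N' W' K κ γ hγ.out
      (UniversalToricDescentTowerTorsion.baseChange_noPTorsion_of_surjective W' 3 hsurj K hK) Dat z) :
    ∃ C : ℕ, ∀ n : ℕ,
      Nat.card {s : (W'.baseChange K).selmerInfty κ |
        3 • s = 0 ∧ (W'.baseChange K).conjH1 3 κ.kerSubgroup (γ ^ 3 ^ n)
          (s : (W'.baseChange K).subgroupH1 3 κ.kerSubgroup) = s} ≤ 3 ^ (3 ^ n + C) := by
  haveI : (W'.baseChange K).IsElliptic := by rw [WeierstrassCurve.baseChange]; infer_instance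
  haveI : Module.Finite (IwasawaAlgebra 3) ((W'.baseChange K).selmerDualData κ hγ.out).X :=
    ((W'.baseChange K).selmerDualData κ hγ.out).module_finite_holds hγ.out
  obtain ⟨k, hk⟩ := hK1
  -- K1 ⟹ non-divisible control images of `z` for `m ≥ 3^k`
  have hndiv := toEisensteinH1Linear_not_mem_of_layerIndivisible Dat F hα hz Dg hk hγ.out
    (UniversalToricDescentTowerTorsion.baseChange_noPTorsion_of_surjective W' 3 hsurj K hK)
  -- `μ(X_tors) = 0` (bounded-index glue) and `rank_Λ X ≤ 1` ((H-ii))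
  have hμ := twin_muInvariant_torsion_eq_zero_of_conclusion W' N' K hm3 hsurj hK hH κ hκ γ Dat z hndiv hconc
  have hrank := UniversalToricDescentTwinHowardRank.twin_hrank_of_conclusion W' N' K hm3 hsurj hK hH κ hκ γ Dat z hconc 0
  have h1 : Module.finrank (IwasawaAlgebra 3) ((W'.baseChange K).selmerDualData κ hγ.out).X ≤ 1 :=
    finrank_le_one_of_lambdaInvariant_quotient_X_pow_add_C_le (p := 3) 0 hrank
  exact k2ResBound_of_finrank_le_one_of_mu_eq_zero W' K κ γ ((W'.baseChange K).selmerDualData κ hγ.out) h1 hμ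

end Summit.BirchSwinnertonDyer.BirchSwinnertonDyer.Theorems.UniversalToricDescentTwinK2ResOfConclusion

end
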